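import Summits.NavierStokesRegularity.FluidComputer.ClayBlowupOfBreakdown
import Summits.NavierStokesRegularity.NavierStokesRegularity.Theorems.SoloInformedClayDichotomy
import HarnessLib

/-!
# The lifespan of Clay data is well defined; Clay (A) ⟺ no UNFORCED Clay blow-up

Cell `ns-blowup`, seat `ns-blowup-ecbridge-2` (g5; the E–C endpoint theory seat). LABEL: E–C typing
(KERNEL — no named fact). WHAT THIS IS NOT: not Navier–Stokes evidence — uniqueness statements about
the TYPE `ClayBlowup` and EQUIVALENCES with the open Clay statements; neither side is asserted.
Companion memo: `run/shared/lean/pub/ns-blowup/ecbridge2/ECBRIDGE-2-MEMO-4.md`.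

## Content

* `ClayBlowup.u_eq_of_data_eq`, **`ClayBlowup.T_eq_of_data_eq`** — two Clay blow-ups at the same
  viscosity with the same datum and force have the same velocity on the common slab AND THE SAME
  LIFESPAN (W14 on closed sub-slabs; a longer one would be a finite-energy continuation of the shorter
  one). So `T*(ν, u₀, f)`, the lifespan of the finite-energy classical evolution, is well defined,
  and the blow-up time of any `DesignedBlowup` with these data IS it (`DesignedBlowup.T_eq_of_data_eq`).
* **`navierStokesRegularity_iff_forall_clayBlowup_force_ne_zero`** — the SUMMIT (Clay (A)) holds iff
  every Clay blow-up, at every viscosity, has a NONZERO force: `(A) ↔ ∀ ν > 0, ∀ X : ClayBlowup ν,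
  X.f ≠ 0` (→: (A) solves the unforced data of `X` globally, contradicting `not_exists_claySolution`;
  ←: the dichotomy `exists_claySolution_or_clayBlowup` with the zero force);
  `navierStokesRegularity_iff_clayBlowup_one_force_ne_zero` — the same at the single viscosity `1`.
* With `navierStokesBreakdownR3_iff_exists_nonempty_clayBlowup` (`ClayBlowupOfBreakdown.lean`): the two
  whole-space Clay statements are, in the kernel, «some Clay blow-up exists» (C) and «no Clay blow-up
  has zero force» (A); both can hold iff a Clay-class force creates a finite lifespan that unforced
  Clay data never have (Tao 2013, after Prop. 1.7) — `regularity_and_breakdown_iff`.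

References: C. L. Fefferman, Clay problem description, (A), (C) [cite: FeffermanClay2006, (A) (C)];
J. Leray, Acta Math. 63 (1934), §32 [cite: Leray1934, §32]; T. Tao, Anal. PDE 6 (2013), Cor. 11.4,
discussion after Prop. 1.7 [cite: Tao2011, Cor. 11.4].
-/

noncomputable section

namespace Summit.NavierStokesRegularity.FluidComputer

open Set MeasureTheory Filter Topology Function
open scoped ENNReal ContDiff NNReal
open Literature.Analysis.FluidPDE
open Summit.NavierStokesRegularity.NavierStokesRegularity
open Summit.NavierStokesRegularity.NavierStokesRegularity.Theorems
open Summit.NavierStokesRegularity.FluidComputer.PalasekTowerClayBridge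

namespace ClayBlowup

variable {ν : ℝ}

/-! ## §1 The lifespan of Clay data is well defined -/

/-- **Two Clay blow-ups with the same data have the same velocity on their common slab** (`ν > 0`;
W14 on the closed sub-slabs `[0, t']`). [cite: Tao2011, Cor. 11.4] -/
theorem u_eq_of_data_eq (hν : 0 < ν) (X Y : ClayBlowup ν) (h0 : X.u 0 = Y.u 0) (hf : X.f = Y.f)
    {t : ℝ} (htX : t ∈ Ico 0 X.T) (htY : t < Y.T) : X.u t = Y.u t := by
  obtain ⟨t', htt', ht'⟩ := exists_between (lt_min htX.2 htY)
  have ht'X : t' < X.T := ht'.trans_le (min_le_left _ _)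
  have ht'Y : t' < Y.T := ht'.trans_le (min_le_right _ _)
  have ht'0 : 0 < t' := htX.1.trans_lt htt'
  have hY : IsClassicalNSSolutionOn (Icc 0 t') ν X.f Y.u Y.p := by
    rw [hf]; exact Y.classical_Icc ht'0 ht'Y
  exact (X.eq_of_classical hν ht'0 ht'X hY (Y.energy t' ht'Y) h0.symm t ⟨htX.1, htt'.le⟩).symm

/-- A Clay blow-up is never SHORTER than another one with the same data: the longer one would be a
finite-energy classical continuation of the shorter. [cite: Leray1934, §32] -/
theorem not_T_lt_of_data_eq (hν : 0 < ν) (X Y : ClayBlowup ν) (h0 : X.u 0 = Y.u 0)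
    (hf : X.f = Y.f) : ¬ X.T < Y.T := by
  intro hlt
  have hY : IsClassicalNSSolutionOn (Ico 0 Y.T) ν X.f Y.u Y.p := by rw [hf]; exact Y.classical
  exact X.no_energy_extension ⟨Y.T, hlt, Y.u, Y.p, hY,
    fun t ht => (X.u_eq_of_data_eq hν Y h0 hf ht (ht.2.trans hlt)).symm, Y.energy⟩

/-- **THE LIFESPAN IS WELL DEFINED**: two Clay blow-ups at the same viscosity `ν > 0` with the same
datum and the same force have the same `T` (Leray's `T*(u₀, f)`). [cite: Leray1934, §32]
[cite: Tao2011, Cor. 11.4] -/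
theorem T_eq_of_data_eq (hν : 0 < ν) (X Y : ClayBlowup ν) (h0 : X.u 0 = Y.u 0) (hf : X.f = Y.f) :
    X.T = Y.T := by
  rcases lt_trichotomy X.T Y.T with h | h | h
  · exact absurd h (X.not_T_lt_of_data_eq hν Y h0 hf)
  · exact h
  · exact absurd h (Y.not_T_lt_of_data_eq hν X h0.symm hf.symm)

/-- The velocities of two Clay blow-ups with the same data agree on the whole (common) slab `[0, T)`.
[cite: Tao2011, Cor. 11.4] -/
theorem u_eq_of_data_eq' (hν : 0 < ν) (X Y : ClayBlowup ν) (h0 : X.u 0 = Y.u 0) (hf : X.f = Y.f)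
    {t : ℝ} (ht : t ∈ Ico 0 X.T) : X.u t = Y.u t :=
  X.u_eq_of_data_eq hν Y h0 hf ht (by rw [← X.T_eq_of_data_eq hν Y h0 hf]; exact ht.2)

end ClayBlowup

/-- **The blow-up time of a designed forced blow-up IS the lifespan of the finite-energy evolution of
its data**: any Clay blow-up with the same datum and force (at the same `ν > 0`) has the same `T`.
[cite: Leray1934, §32] -/
theorem DesignedBlowup.T_eq_of_data_eq {ν : ℝ} (hν : 0 < ν) (D : DesignedBlowup ν) (X : ClayBlowup ν)
    (h0 : D.u 0 = X.u 0) (hf : D.f = X.f) : D.T = X.T :=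
  D.toClayBlowup.T_eq_of_data_eq hν X h0 hf

/-! ## §2 Clay (A) ⟺ no unforced Clay blow-up -/

/-- **THE SUMMIT IS «NO UNFORCED CLAY BLOW-UP»**: Clay (A) (`NavierStokesRegularity`: every Clay datum
has a global smooth bounded-energy solution of the UNFORCED system at every `ν > 0`) holds iff every
Clay blow-up at every viscosity has a nonzero force. (→) (A) solves the data `(u(0), 0)` of an unforced
blow-up globally, contradicting `ClayBlowup.not_exists_claySolution`; (←) the dichotomy
`ClayEvolution.exists_claySolution_or_clayBlowup` with the Clay-class force `0`. No named fact.
[cite: FeffermanClay2006, (A)] [cite: Leray1934, §32] -/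
theorem navierStokesRegularity_iff_forall_clayBlowup_force_ne_zero :
    _root_.NavierStokesRegularity ↔ ∀ ν : ℝ, 0 < ν → ∀ X : ClayBlowup ν, X.f ≠ 0 := by
  constructor
  · intro hA ν hν X hf0
    obtain ⟨u, p, hu, hp, hns, hE⟩ := hA ν hν (X.u 0) X.contDiff_datum X.divFree_datum X.datum_decay
    refine X.not_exists_claySolution hν ⟨u, p, hu, hp, ?_, hE⟩
    rw [hf0]
    exact hns
  · intro h ν hν u₀ hu₀ hdiv hdec
    rcases ClayEvolution.exists_claySolution_or_clayBlowup (f := 0) hν hu₀ hdiv hdec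
        isSmoothOnHalfSpace_zero hasRapidSpaceTimeDecay_zero with hsol | ⟨B, -, hBf⟩
    · exact hsol
    · exact absurd hBf (h ν hν B)

/-- **Clay (A) at the single viscosity `1`**: the summit holds iff every Clay blow-up at viscosity `1`
has a nonzero force (an unforced blow-up at `ν` rescales to an unforced one at `1`).
[cite: FeffermanClay2006, (A)] [cite: Tao2011, footnote 3] -/
theorem navierStokesRegularity_iff_clayBlowup_one_force_ne_zero :
    _root_.NavierStokesRegularity ↔ ∀ X : ClayBlowup 1, X.f ≠ 0 := by
  rw [navierStokesRegularity_iff_forall_clayBlowup_force_ne_zero]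
  constructor
  · exact fun h X => h 1 one_pos X
  · intro h ν hν X hf0
    refine h (X.rescale hν one_pos) ?_
    change timeRescale (1 / ν) ((1 / ν) ^ 2) X.f = 0
    rw [hf0, timeRescale_zero_force]

/-- **(A) and (C) together ⟺ forced blow-up without unforced blow-up.** Both whole-space Clay
statements hold iff some Clay blow-up exists while none has zero force — i.e. iff a Clay-class force
can end the finite-energy classical evolution in finite time although unforced Clay data never do
(Tao 2013, discussion after Prop. 1.7: whether forcing can create singularities is open).
[cite: FeffermanClay2006, (A) (C)] [cite: Tao2011, Prop. 1.7] -/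
theorem regularity_and_breakdown_iff :
    (_root_.NavierStokesRegularity ∧
        Summit.NavierStokesRegularity.NavierStokesRegularity.NavierStokesBreakdownR3) ↔
      (∃ ν : ℝ, 0 < ν ∧ Nonempty (ClayBlowup ν)) ∧ ∀ ν : ℝ, 0 < ν → ∀ X : ClayBlowup ν, X.f ≠ 0 := by
  rw [navierStokesRegularity_iff_forall_clayBlowup_force_ne_zero,
    navierStokesBreakdownR3_iff_exists_nonempty_clayBlowup]
  exact and_comm

end Summit.NavierStokesRegularity.FluidComputer

end
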